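import Summits.CriticalPhenomena.PercolationContinuityZ3.Theorems.PercNearOneGluingNoHeavyQuantSDEC
import HarnessLib

/-!
# QUANT lane R8, heavy node, REGIME M (`k < min(t₁,t₂)`): the explicit PURE-TILT certificate (`LawDec.regimeM_certificate`)

builds on p205010 (kernel theorem, internal audit signed; external expert review pending)

Support file (`--supports stmt-CriticalPhenomena-4575`), QUANT lane typer seat prim-quant-stmt (gen 34), rung R8; memo
`run/shared/lean/prim/quant/prim-quant-stmt-g34/PHANTOM-QFREE-G34.md` §3.  Theorems only (pure real arithmetic; imports `…QuantSDEC` just for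
Mathlib/HarnessLib), standard axioms, no sorries.

THE CERTIFICATE.  In the q-free principle `LawDec.gate_lconv_row_of_universalCertificate` (`…QuantUniversalCertificate`, ✓ p377956) take NO
reflections (`lam = kap = 0`), the constant row tilt `ρ₁ ≡ ρ := u/(t₁+t₂−k)` and the column tilts
`ρ₂(a) := max( (u − t₁ρ)/t₂ , max_{s ≤ M₂, s < t₂} (ρ(a−t₁) − K⁰(a+s))/(t₂−s) )`, `K⁰(n) = [t₁+t₂−k ≤ n] − u·[n ≤ k]`.
**`regimeM_certificate`**: for `0 < u`, `0 < t₁, t₂`, `Mᵢ ≤ tᵢ(1 + 1/u)` (top-affordability) and `k < min(t₁,t₂)` there is `ρ₂ : ℕ → ℝ` with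
(E0) `ρ(a−t₁) + ρ₂(a)(s−t₂) ≤ K⁰(a+s)` on `{0..M₁}×{0..M₂}` and (E1) `1 ≤ t₁ρ/u + t₂ρ₂(a)/u` for every `a ≤ M₁` — i.e. exactly the hypotheses
`hE0`/`hE1` of the principle with `lam = kap = 0` (`1/u = (1−y)/y`).  CONSEQUENCE (one `obtain` + the principle, to be filed as soon as the farm has built
`…QuantUniversalCertificate`): every row `k < min(qT₁, qT₂)` of `LawDec.TLBGateConvClosedHeavy`'s conclusion holds for EVERY floor `0 < y < 1` and every
gate, from the two means and top-affordability ALONE (no two-layer hypothesis on the factors).  The complementary regime `k ≥ min(qT₁,qT₂)` is arm-2's S*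
plus weight-1 reflections `c = 0` on the rows `s > k` (memo §4).  Exact checks of this certificate: `explore/regM.py`, `thmB_cert.py` (> 60 000 instances / 0).

PROOF (memo §3).  (E1): `t₁ρ + t₂·r_min = u`.  (E0) at `s < t₂`: `ρ₂(a)` dominates the `s`-term of the max; at `s = t₂`: `ρ(a−t₁) ≤ K⁰`; at `s > t₂` the
left side increases with `ρ₂(a)`, and every candidate of the max satisfies the bound: the `r_min` candidate by `regimeM_candY`, the `s₀` candidates by
`regimeM_candP` (five sign cases of `(K⁰(a+s), K⁰(a+s₀))`).  Only `Mᵢ ≤ tᵢ(1+1/u)` and `k < tᵢ` are used; `u ≥ 1` is NOT needed in this regime.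

[this work].  The gluing rows served [cite: KozmaNitzan2024, Conjecture 3 (p. 15)]; product measure [cite: Grimmett1999, §1.3 p. 10].
-/

noncomputable section

namespace Summit.CriticalPhenomena.PercolationContinuityZ3.Theorems

namespace Quant

open Finset

namespace LawDec

/-! ### The two candidate inequalities (pure real arithmetic) -/

/-- **candidate `r_min`** (memo §3 (Y)): for a cell `(a, s′)` with `s′ > t₂`,
`ρ(a−t₁) + r_min(s′−t₂) ≤ K⁰(a+s′)`, `ρ = u/(t−k)`, `r_min = (u − t₁ρ)/t₂`. [this work] -/
theorem regimeM_candY (u t₁ t₂ : ℝ) (k a s' : ℕ) (hu : 0 < u) (ht₂ : 0 < t₂) (hk₁ : (k : ℝ) < t₁) (hk₂ : (k : ℝ) < t₂)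
    (haM : u * (a : ℝ) ≤ t₁ * (u + 1)) (hs' : t₂ < (s' : ℝ)) (hs'M : u * (s' : ℝ) ≤ t₂ * (u + 1)) :
    u / (t₁ + t₂ - k) * ((a : ℝ) - t₁) + (u - t₁ * (u / (t₁ + t₂ - k))) / t₂ * ((s' : ℝ) - t₂)
      ≤ (if t₁ + t₂ - k ≤ ((a + s' : ℕ) : ℝ) then (1 : ℝ) else 0) - u * (if a + s' ≤ k then (1 : ℝ) else 0) := by
  have hk0 : (0 : ℝ) ≤ k := Nat.cast_nonneg k
  have htk : 0 < t₁ + t₂ - k := by linarith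
  have hnl : ¬ (a + s' ≤ k) := by
    intro h
    have : ((a + s' : ℕ) : ℝ) ≤ k := by exact_mod_cast h
    push_cast at this; linarith
  rw [if_neg hnl, mul_zero, sub_zero]
  have e1 : (u - t₁ * (u / (t₁ + t₂ - k))) / t₂ = u * (t₂ - k) / (t₂ * (t₁ + t₂ - k)) := by
    field_simp
    ring
  rw [e1, div_mul_eq_mul_div, div_mul_eq_mul_div, div_add_div _ _ (ne_of_gt htk) (ne_of_gt (mul_pos ht₂ htk))]
  have hD : 0 < (t₁ + t₂ - k) * (t₂ * (t₁ + t₂ - k)) := mul_pos htk (mul_pos ht₂ htk)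
  split_ifs with htar
  · -- target cell: numerator `≤` denominator
    rw [div_le_one hD]
    have h1 : u * ((a : ℝ) - t₁) ≤ t₁ := by nlinarith
    have h2 : u * ((s' : ℝ) - t₂) ≤ t₂ := by nlinarith
    have h3 : (0 : ℝ) ≤ t₂ - k := by linarith
    have h4 : u * (t₂ - k) * ((s' : ℝ) - t₂) ≤ (t₂ - k) * t₂ := by nlinarith [mul_le_mul_of_nonneg_left h2 h3]
    have h5 : u * ((a : ℝ) - t₁) * (t₂ * (t₁ + t₂ - k)) ≤ t₁ * (t₂ * (t₁ + t₂ - k)) :=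
      mul_le_mul_of_nonneg_right h1 (mul_pos ht₂ htk).le
    nlinarith [mul_le_mul_of_nonneg_right h4 htk.le]
  · -- middle cell: `a + s′ < t − k`; the numerator is `≤ −u(t−k)·k·s′ ≤ 0`
    push Not at htar
    have htar' : (a : ℝ) + s' < t₁ + t₂ - k := by push_cast at htar; linarith
    rw [div_le_iff₀ hD, zero_mul]
    have hpos : 0 ≤ u * (t₂ * (t₁ + t₂ - k)) := by positivity
    have h1 : u * ((a : ℝ) - t₁) * (t₂ * (t₁ + t₂ - k)) ≤ u * (t₂ - k - s') * (t₂ * (t₁ + t₂ - k)) := by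
      have : (a : ℝ) - t₁ ≤ t₂ - k - s' := by linarith
      nlinarith [mul_le_mul_of_nonneg_left this hpos]
    have h2 : u * (t₂ - k - (s' : ℝ)) * (t₂ * (t₁ + t₂ - k)) + u * (t₂ - k) * ((s' : ℝ) - t₂) * (t₁ + t₂ - k)
        = - ((u * (t₁ + t₂ - k)) * ((k : ℝ) * s')) := by ring
    have h3 : 0 ≤ (u * (t₁ + t₂ - k)) * ((k : ℝ) * s') := by
      have : (0 : ℝ) ≤ (k : ℝ) * s' := by positivity
      positivity
    linarith

/-- **candidate `s₀`** (memo §3 (P)): for `s₀ < t₂ < s′` (`w₀ = t₂ − s₀`, `w′ = s′ − t₂`) and `A = a − t₁`,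
`ρA(w₀ + w′) ≤ K⁰(a+s′)·w₀ + K⁰(a+s₀)·w′`. [this work] -/
theorem regimeM_candP (u t₁ t₂ : ℝ) (k a s₀ s' : ℕ) (hu : 0 < u) (ht₂ : 0 < t₂) (hk₁ : (k : ℝ) < t₁) (hk₂ : (k : ℝ) < t₂)
    (haM : u * (a : ℝ) ≤ t₁ * (u + 1)) (hs₀ : (s₀ : ℝ) < t₂) (hs' : t₂ < (s' : ℝ)) (hs'M : u * (s' : ℝ) ≤ t₂ * (u + 1)) :
    u / (t₁ + t₂ - k) * ((a : ℝ) - t₁) * ((t₂ - s₀) + ((s' : ℝ) - t₂))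
      ≤ ((if t₁ + t₂ - k ≤ ((a + s' : ℕ) : ℝ) then (1 : ℝ) else 0) - u * (if a + s' ≤ k then (1 : ℝ) else 0)) * (t₂ - s₀)
        + ((if t₁ + t₂ - k ≤ ((a + s₀ : ℕ) : ℝ) then (1 : ℝ) else 0) - u * (if a + s₀ ≤ k then (1 : ℝ) else 0)) * ((s' : ℝ) - t₂) := by
  have hk0 : (0 : ℝ) ≤ k := Nat.cast_nonneg k
  have ha0 : (0 : ℝ) ≤ a := Nat.cast_nonneg a
  have hs₀0 : (0 : ℝ) ≤ s₀ := Nat.cast_nonneg s₀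
  have htk : 0 < t₁ + t₂ - k := by linarith
  have hw₀ : 0 < t₂ - (s₀ : ℝ) := by linarith
  have hw' : 0 < (s' : ℝ) - t₂ := by linarith
  have hw'u : u * ((s' : ℝ) - t₂) ≤ t₂ := by nlinarith
  have huA : u * ((a : ℝ) - t₁) ≤ t₁ := by nlinarith
  have hρ : 0 < u / (t₁ + t₂ - k) := div_pos hu htk
  have hsum : 0 < (t₂ - s₀) + ((s' : ℝ) - t₂) := by linarith
  -- `(a, s′)` is never a low cell
  have hnl' : ¬ (a + s' ≤ k) := by
    intro h
    have : ((a + s' : ℕ) : ℝ) ≤ k := by exact_mod_cast h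
    push_cast at this; linarith
  rw [if_neg hnl', mul_zero, sub_zero]
  -- rewrite `ρA·W ≤ …` as `uA·W ≤ (t−k)·…`
  rw [div_mul_eq_mul_div, div_mul_eq_mul_div, div_le_iff₀ htk]
  by_cases hApos : 0 < (a : ℝ) - t₁
  · -- `A > 0`: `a + s₀ > k` and `a + s′ ≥ t − k`
    have hn₀ : ¬ (a + s₀ ≤ k) := by
      intro h
      have : ((a + s₀ : ℕ) : ℝ) ≤ k := by exact_mod_cast h
      push_cast at this; linarith
    have hn' : t₁ + t₂ - k ≤ ((a + s' : ℕ) : ℝ) := by push_cast; linarith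
    rw [if_neg hn₀, if_pos hn', mul_zero, sub_zero, one_mul]
    split_ifs with h₀
    · -- `(1, 1)`: `uA ≤ t₁ < t − k`
      rw [one_mul]
      nlinarith [mul_le_mul_of_nonneg_right huA hsum.le]
    · -- `(1, 0)`: `A < w₀ − k`
      rw [zero_mul, add_zero]
      have h₀' : (a : ℝ) + s₀ < t₁ + t₂ - k := by push Not at h₀; push_cast at h₀; linarith
      have hAw : (a : ℝ) - t₁ ≤ (t₂ - s₀) - k := by linarith
      -- `uA·w′ ≤ A·t₂`
      have e1 : u * ((a : ℝ) - t₁) * ((s' : ℝ) - t₂) ≤ ((a : ℝ) - t₁) * t₂ := by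
        nlinarith [mul_le_mul_of_nonneg_left hw'u hApos.le]
      by_cases hcase : u * ((t₂ - s₀) - k) ≤ t₁
      · have e2 : u * ((a : ℝ) - t₁) * (t₂ - s₀) ≤ u * ((t₂ - s₀) - k) * (t₂ - s₀) := by
          nlinarith [mul_le_mul_of_nonneg_right hAw (mul_pos hu hw₀).le]
        have e3 : ((a : ℝ) - t₁) * t₂ ≤ ((t₂ - s₀) - k) * t₂ := mul_le_mul_of_nonneg_right hAw ht₂.le
        have p1 : 0 ≤ (t₂ - (s₀ : ℝ)) * (t₁ - u * ((t₂ - s₀) - k)) := mul_nonneg hw₀.le (by linarith)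
        have p2 : (0 : ℝ) ≤ (k : ℝ) * s₀ := mul_nonneg hk0 hs₀0
        have e4 : u * ((t₂ - (s₀ : ℝ)) - k) * (t₂ - s₀) + ((t₂ - (s₀ : ℝ)) - k) * t₂
            = (t₂ - s₀) * (t₁ + t₂ - k) - ((t₂ - (s₀ : ℝ)) * (t₁ - u * ((t₂ - s₀) - k)) + (k : ℝ) * s₀) := by ring
        linear_combination e1 + e2 + e3 + p1 + p2 + e4
      · push Not at hcase
        have e2 : u * ((a : ℝ) - t₁) * (t₂ - s₀) ≤ t₁ * (t₂ - s₀) := mul_le_mul_of_nonneg_right huA hw₀.le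
        -- `u·(A t₂) ≤ t₁ t₂`
        have e3 : u * (((a : ℝ) - t₁) * t₂) ≤ t₁ * t₂ := by nlinarith
        -- `t₁ t₂ ≤ u w₀ (t₂ − k)` from `u(w₀ − k) > t₁`:  `u w₀(t₂−k) − t₁t₂ = (u(w₀−k) − t₁)(t₂−k)·… `
        have hk2' : (0 : ℝ) ≤ t₂ - k := by linarith
        have e5 : t₁ * t₂ ≤ u * (t₂ - s₀) * (t₂ - k) := by
          have q1 : t₁ * (t₂ - k) ≤ u * ((t₂ - s₀) - k) * (t₂ - k) := mul_le_mul_of_nonneg_right hcase.le hk2'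
          have q2 : u * ((t₂ - (s₀ : ℝ)) - k) * (t₂ - k) = u * (t₂ - s₀) * (t₂ - k) - u * k * (t₂ - k) := by ring
          -- need t₁ t₂ − t₁(t₂ − k) = t₁ k ≤ u w₀(t₂ − k) − u(w₀−k)(t₂−k) = u k (t₂ − k)  ⟸  t₁ ≤ u(t₂ − k)  ⟸ hcase (s₀ ≥ 0)
          have q3 : t₁ * (k : ℝ) ≤ u * (t₂ - k) * k := by
            have : t₁ < u * (t₂ - k) := by nlinarith
            exact mul_le_mul_of_nonneg_right this.le hk0
          nlinarith
        -- conclude: multiply the goal by `u`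
        have key : u * (u * ((a : ℝ) - t₁) * (t₂ - s₀ + ((s' : ℝ) - t₂))) ≤ u * ((t₂ - s₀) * (t₁ + t₂ - k)) := by
          have x1 : u * (u * ((a : ℝ) - t₁) * (t₂ - s₀ + ((s' : ℝ) - t₂)))
              = u * (u * ((a : ℝ) - t₁) * (t₂ - s₀)) + u * (u * ((a : ℝ) - t₁) * ((s' : ℝ) - t₂)) := by ring
          have x2 : u * (u * ((a : ℝ) - t₁) * ((s' : ℝ) - t₂)) ≤ u * (((a : ℝ) - t₁) * t₂) := mul_le_mul_of_nonneg_left e1 hu.le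
          have x3 : u * (u * ((a : ℝ) - t₁) * (t₂ - s₀)) ≤ u * (t₁ * (t₂ - s₀)) := mul_le_mul_of_nonneg_left e2 hu.le
          have x4 : u * ((t₂ - s₀) * (t₁ + t₂ - k)) = u * (t₁ * (t₂ - s₀)) + u * (t₂ - s₀) * (t₂ - k) := by ring
          linarith
        exact le_of_mul_le_mul_left key hu
  · -- `A ≤ 0`
    push Not at hApos
    have hLHS : u * ((a : ℝ) - t₁) * (t₂ - s₀ + ((s' : ℝ) - t₂)) ≤ 0 :=
      mul_nonpos_of_nonpos_of_nonneg (mul_nonpos_of_nonneg_of_nonpos hu.le hApos) hsum.le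
    by_cases hl₀ : a + s₀ ≤ k
    · -- low cell `(a, s₀)`: `K₀ = −u`, `A ≤ −D`, `D = t₁ + s₀ − k`
      have hl₀' : (a : ℝ) + s₀ ≤ k := by exact_mod_cast hl₀
      have hnt₀ : ¬ (t₁ + t₂ - k ≤ ((a + s₀ : ℕ) : ℝ)) := by push_cast; linarith
      rw [if_pos hl₀, if_neg hnt₀, zero_sub, mul_one]
      have hD : (a : ℝ) - t₁ ≤ -(t₁ + s₀ - k) := by linarith
      have hW : 0 ≤ u * (t₂ - s₀ + ((s' : ℝ) - t₂)) := by positivity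
      have e1 : u * (t₂ - s₀ + ((s' : ℝ) - t₂)) * ((a : ℝ) - t₁) ≤ u * (t₂ - s₀ + ((s' : ℝ) - t₂)) * (-(t₁ + s₀ - k)) :=
        mul_le_mul_of_nonneg_left hD hW
      split_ifs with hn'
      · -- `(1, −u)`
        rw [one_mul]
        have e3 : 0 ≤ (t₁ + (s₀ : ℝ) - k) + (t₂ - s₀) + u * (t₁ + s₀ - k) - u * ((s' : ℝ) - t₂) := by
          have := mul_nonneg hu.le (show (0:ℝ) ≤ t₁ + s₀ - k by linarith)
          linarith
        have e4 := mul_nonneg hw₀.le e3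
        linear_combination e1 + e4
      · -- `(0, −u)`: `w′ ≤ D`
        push Not at hn'
        rw [zero_mul, zero_add]
        have hDw : (s' : ℝ) - t₂ ≤ t₁ + s₀ - k := by push_cast at hn'; linarith
        have e5 := mul_le_mul_of_nonneg_left hDw (mul_pos hu hw₀).le
        linear_combination e1 + e5
    · rw [if_neg hl₀, mul_zero, sub_zero]
      -- `K₀ ∈ {0,1}`, `K′ ≥ 0`: RHS ≥ 0 ≥ LHS
      have hRHS : 0 ≤ (if t₁ + t₂ - k ≤ ((a + s' : ℕ) : ℝ) then (1 : ℝ) else 0) * (t₂ - s₀)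
          + (if t₁ + t₂ - k ≤ ((a + s₀ : ℕ) : ℝ) then (1 : ℝ) else 0) * ((s' : ℝ) - t₂) := by
        have i1 : 0 ≤ (if t₁ + t₂ - k ≤ ((a + s' : ℕ) : ℝ) then (1 : ℝ) else 0) := by split_ifs <;> norm_num
        have i2 : 0 ≤ (if t₁ + t₂ - k ≤ ((a + s₀ : ℕ) : ℝ) then (1 : ℝ) else 0) := by split_ifs <;> norm_num
        positivity
      exact hLHS.trans (mul_nonneg hRHS htk.le)

/-! ### The certificate -/

/-- **REGIME M OF THE HEAVY NODE: THE PURE-TILT CERTIFICATE** (typer g34, memo PHANTOM-QFREE-G34 §3).  For `0 < u`, `0 < t₁`, `0 < t₂`, integers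
`M₁ ≤ t₁(1+1/u)`, `M₂ ≤ t₂(1+1/u)` and `k < min(t₁, t₂)`, there is `ρ₂ : ℕ → ℝ` such that, with `ρ := u/(t₁+t₂−k)`,
(E0) `ρ(a − t₁) + ρ₂ a·(s − t₂) ≤ [t₁+t₂−k ≤ a+s] − u·[a+s ≤ k]` for all `a ≤ M₁`, `s ≤ M₂`, and (E1) `1 ≤ t₁ρ/u + t₂ρ₂ a/u` for all `a ≤ M₁` —
the hypotheses `hE0`, `hE1` of `LawDec.gate_lconv_row_of_universalCertificate` with `lam = kap = 0`, `ρ₁ ≡ ρ` (note `(1−y)/y = 1/u`).  Hence every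
row `k < min(qT₁, qT₂)` of the gated two-layer bound of `gate (lconv μ₁ μ₂) q` follows from the two means and top-affordability alone, for every
floor `0 < y < 1`. [this work] -/
theorem regimeM_certificate (u t₁ t₂ : ℝ) (M₁ M₂ k : ℕ) (hu : 0 < u) (ht₁ : 0 < t₁) (ht₂ : 0 < t₂)
    (hM₁ : (M₁ : ℝ) ≤ t₁ * (1 + 1 / u)) (hM₂ : (M₂ : ℝ) ≤ t₂ * (1 + 1 / u)) (hk₁ : (k : ℝ) < t₁) (hk₂ : (k : ℝ) < t₂) :
    ∃ ρ₂ : ℕ → ℝ,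
      (∀ a ∈ Finset.range (M₁ + 1), ∀ s ∈ Finset.range (M₂ + 1),
        u / (t₁ + t₂ - k) * ((a : ℝ) - t₁) + ρ₂ a * ((s : ℝ) - t₂)
          ≤ (if t₁ + t₂ - k ≤ ((a + s : ℕ) : ℝ) then (1 : ℝ) else 0) - u * (if a + s ≤ k then (1 : ℝ) else 0))
      ∧ (∀ a ∈ Finset.range (M₁ + 1), 1 ≤ 1 / u * t₁ * (u / (t₁ + t₂ - k)) + 1 / u * t₂ * ρ₂ a) := by
  have htk : 0 < t₁ + t₂ - k := by linarith
  have hk0 : (0 : ℝ) ≤ k := Nat.cast_nonneg k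
  -- the kernel at a cell and the `s`-candidates of the max
  set K : ℕ → ℕ → ℝ := fun a s =>
    (if t₁ + t₂ - k ≤ ((a + s : ℕ) : ℝ) then (1 : ℝ) else 0) - u * (if a + s ≤ k then (1 : ℝ) else 0) with hK
  set L : ℕ → ℕ → ℝ := fun a s => (u / (t₁ + t₂ - k) * ((a : ℝ) - t₁) - K a s) / (t₂ - s) with hL
  set lowS : Finset ℕ := (Finset.range (M₂ + 1)).filter (fun s => (s : ℝ) < t₂) with hlowS
  refine ⟨fun a => lowS.fold max ((u - t₁ * (u / (t₁ + t₂ - k))) / t₂) (L a), ?_, ?_⟩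
  · intro a ha s hs
    rw [Finset.mem_range] at ha hs
    have haM : (a : ℝ) ≤ M₁ := by exact_mod_cast Nat.lt_succ_iff.mp ha
    have hsM : (s : ℝ) ≤ M₂ := by exact_mod_cast Nat.lt_succ_iff.mp hs
    have haM' : u * (a : ℝ) ≤ t₁ * (u + 1) := by
      have h1 : (a : ℝ) ≤ t₁ * (1 + 1 / u) := haM.trans hM₁
      have h2 : t₁ * (1 + 1 / u) * u = t₁ * (u + 1) := by field_simp
      nlinarith
    have hsM' : u * (s : ℝ) ≤ t₂ * (u + 1) := by
      have h1 : (s : ℝ) ≤ t₂ * (1 + 1 / u) := hsM.trans hM₂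
      have h2 : t₂ * (1 + 1 / u) * u = t₂ * (u + 1) := by field_simp
      nlinarith
    show u / (t₁ + t₂ - k) * ((a : ℝ) - t₁) + lowS.fold max ((u - t₁ * (u / (t₁ + t₂ - k))) / t₂) (L a) * ((s : ℝ) - t₂) ≤ K a s
    rcases lt_trichotomy (s : ℝ) t₂ with hlt | heq | hgt
    · -- `s < t₂`: the `s`-candidate of the max dominates
      have hmem : s ∈ lowS := by rw [hlowS, Finset.mem_filter, Finset.mem_range]; exact ⟨hs, hlt⟩
      have hge : L a s ≤ lowS.fold max ((u - t₁ * (u / (t₁ + t₂ - k))) / t₂) (L a) := by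
        rw [Finset.le_fold_max]; exact Or.inr ⟨s, hmem, le_rfl⟩
      have hneg : (s : ℝ) - t₂ ≤ 0 := by linarith
      have h1 := mul_le_mul_of_nonpos_right hge hneg
      have h2 : L a s * ((s : ℝ) - t₂) = -(u / (t₁ + t₂ - k) * ((a : ℝ) - t₁) - K a s) := by
        rw [hL]; field_simp [ne_of_gt (show (0:ℝ) < t₂ - s by linarith)]; ring
      linarith
    · -- `s = t₂`
      rw [heq, sub_self, mul_zero, add_zero, hK]
      have hnl : ¬ (a + s ≤ k) := by
        intro h
        have : ((a + s : ℕ) : ℝ) ≤ k := by exact_mod_cast h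
        push_cast at this; linarith
      simp only [hnl, if_false, mul_zero, sub_zero]
      by_cases hat : (a : ℝ) < t₁ - k
      · have : u / (t₁ + t₂ - k) * ((a : ℝ) - t₁) ≤ 0 :=
          mul_nonpos_of_nonneg_of_nonpos (div_pos hu htk).le (by linarith)
        split_ifs <;> linarith
      · push Not at hat
        have htar : t₁ + t₂ - k ≤ ((a + s : ℕ) : ℝ) := by push_cast; linarith
        rw [if_pos htar, div_mul_eq_mul_div, div_le_one htk]
        nlinarith
    · -- `s > t₂`: every candidate of the max obeys the upper bound `(K − ρA)/(s − t₂)`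
      have hspos : 0 < (s : ℝ) - t₂ := by linarith
      suffices hub : lowS.fold max ((u - t₁ * (u / (t₁ + t₂ - k))) / t₂) (L a)
          ≤ (K a s - u / (t₁ + t₂ - k) * ((a : ℝ) - t₁)) / ((s : ℝ) - t₂) by
        have := mul_le_mul_of_nonneg_right hub hspos.le
        rw [div_mul_cancel₀ _ (ne_of_gt hspos)] at this
        linarith
      rw [Finset.fold_max_le]
      constructor
      · -- the `r_min` candidate (Y)
        rw [le_div_iff₀ hspos]
        have := regimeM_candY u t₁ t₂ k a s hu ht₂ hk₁ hk₂ haM' hgt hsM'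
        rw [hK]
        linarith
      · -- the `s₀` candidates (P)
        intro s₀ hs₀
        rw [hlowS, Finset.mem_filter, Finset.mem_range] at hs₀
        obtain ⟨_, hs₀t⟩ := hs₀
        have hw₀ : 0 < t₂ - (s₀ : ℝ) := by linarith
        show (u / (t₁ + t₂ - k) * ((a : ℝ) - t₁) - K a s₀) / (t₂ - s₀)
          ≤ (K a s - u / (t₁ + t₂ - k) * ((a : ℝ) - t₁)) / ((s : ℝ) - t₂)
        rw [div_le_div_iff₀ hw₀ hspos]
        have := regimeM_candP u t₁ t₂ k a s₀ s hu ht₂ hk₁ hk₂ haM' hs₀t hgt hsM'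
        rw [hK]
        nlinarith [this]
  · intro a _
    have hge : (u - t₁ * (u / (t₁ + t₂ - k))) / t₂ ≤ lowS.fold max ((u - t₁ * (u / (t₁ + t₂ - k))) / t₂) (L a) := by
      rw [Finset.le_fold_max]; exact Or.inl le_rfl
    have e : 1 / u * t₁ * (u / (t₁ + t₂ - k)) + 1 / u * t₂ * ((u - t₁ * (u / (t₁ + t₂ - k))) / t₂) = 1 := by
      field_simp
      ring
    have : 1 / u * t₂ * ((u - t₁ * (u / (t₁ + t₂ - k))) / t₂)
        ≤ 1 / u * t₂ * lowS.fold max ((u - t₁ * (u / (t₁ + t₂ - k))) / t₂) (L a) :=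
      mul_le_mul_of_nonneg_left hge (by positivity)
    linarith

end LawDec

end Quant

end Summit.CriticalPhenomena.PercolationContinuityZ3.Theorems
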